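import Mathlib
import Literature.AlgebraicGeometry.HodgeTheory.WeilClasses
import Literature.AlgebraicGeometry.HodgeTheory.WeilClassesFourfolds
import Literature.AlgebraicGeometry.HodgeTheory.AbelianLowDimensionHodgeConjecture
import Literature.AlgebraicGeometry.HodgeTheory.HodgeClassesDimLEThreeProofs
import Literature.AlgebraicGeometry.HodgeTheory.ComplexConjugationHolds
import Literature.AlgebraicGeometry.HodgeTheory.AlgebraicClassesCupAbelianVariety
import Literature.AlgebraicGeometry.HodgeTheory.WeilClassesSurfacesProofs
import Literature.AlgebraicGeometry.HodgeTheory.WeilClassesFourfoldsProofs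
import Literature.Barriers.HodgeConjecture.ExceptionalHodgeClasses
import HarnessLib

/-!
# AbelianLowDimensionWeilReduction

Topic `Literature/AlgebraicGeometry/HodgeTheory`. Named literature fact(s) relocated by the gate from `Summits/HodgeConjecture/HodgeConjecture/Theorems/PadicSemiregularLiftHodgeAbelianVarietiesStubWeilSectorSuffices.lean`
(accept-time relocation of `[cite]`d propositions written inline in a Summits proposal; human ruling 2026-08-15).
Sources: Markman2025SurveySecant, MoonenZarhin1995Duke, MoonenZarhin1999LowDim, RamonMari2008, vanGeemen1994HodgeAV.

* `Literature.AlgebraicGeometry.HodgeTheory.MoonenZarhin1999_hodgeClasses_abelian_dim_le_five_of_weilClassesFourfolds`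
-/

namespace Literature.AlgebraicGeometry.HodgeTheory

open CategoryTheory
open Literature.AlgebraicGeometry Literature.AlgebraicGeometry.Motives

/-- **Moonen–Zarhin 1999 (Math. Ann. 315, Thms. 0.1–0.2; with Moonen–Zarhin 1995 and Tankeev for
simple abelian varieties, Ramón Marí 2008 Prop. 2.18 for products of abelian surfaces), as combined
by Markman (arXiv:2509.23403 §1.1, proof of Cor. 1.3): on a complex abelian variety of dimension
`≤ 5` every Hodge class is a polynomial in divisor classes and (pull-backs of) Weil classes of
abelian FOURFOLDS — so the algebraicity of the Weil classes of abelian fourfolds implies that of every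
Hodge class in dimension `≤ 5`** (a THEOREM in print; proved in print, not in the tree).
Moonen–Zarhin, Introduction: "If `dim(X) ≤ 3` then every Hodge class on `X` is a linear combination
of products of divisor classes. … if `X` is simple of dimension 4 then every Hodge class is a linear
combination of products of divisor classes and Weil classes—if there are any. … The aim of this note
is to extend this to arbitrary abelian varieties of dimension `≤ 5`"; Thm. 0.1 (`dim X ≤ 4`): in
cases (a), (b) "the Hodge ring `B•(X)` is generated by the subalgebra `D•(X)` of divisor classes
together with the space of Weil classes `W_k ⊂ B²(X)`", in case (c) "together with the spaces of
Weil classes `W_k ⊂ B²(X)`, where `k` runs through the set of imaginary quadratic fields contained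
in `D`", otherwise `B• = D•`; Thm. 0.2 (`dim X = 5`): in cases (e), (f) `B•(X)` "is generated by the
divisor classes `D•(X)` together with the pull-backs of the Weil classes in `W_k ⊂ B²(X₁ × X₂)`"
(along a surjective homomorphism `X → X₁ × X₂` onto an abelian FOURFOLD), otherwise by divisor
classes / the Hodge rings of the factors; (1.9): `W_K := ⋀ʳ_K V_X^∨ ⊂ Hʳ(X, ℚ)`, and "either `W_K`
consists entirely of Hodge classes or `0 ∈ W_K` is the only Hodge class in `W_K`". Markman, §1.1:
"The Hodge ring of abelian fourfolds is generated by divisor classes and Weil classes for complex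
multiplication by possibly more than one imaginary quadratic number field, by work of Moonen and
Zarhin … combined with a result of Ramón Marí in the case of products of abelian surfaces. The Hodge
ring for simple abelian varieties of prime dimension is generated by divisor classes, by a result of
Tankeev. If `X` is a non-simple abelian variety of dimension `5`, then the Hodge ring of `X` is
generated by divisor classes and pull backs of Weil classes from quotient abelian fourfolds …
Combining these results with Theorem 1.2 we get: Corollary 1.3" (the `dim ≤ 5` case of the summit
statement), and Abstract: the `dim ≤ 5` case "is known to follow from the latter result", sc. "the
algebraicity of the Weil classes on all abelian fourfold(s) of Weil type". Rendering, as the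
implication between two statements already vendored on the real carriers: IF for every `d ≥ 1`,
every complex abelian fourfold `B` and every `φ : B ⟶ B` with `φ ≫ φ = -(d • 𝟙 B)` the rational
`(2,2)`-classes of the Weil plane `weilClassesOf B φ 2 d = E₊ ⊔ E₋ = W_k ⊗ ℂ` (`k = ℚ(√-d)`; van
Geemen LNM 1594, proof of Thm. 6.12) are algebraic (`Markman2025_weilClasses_algebraic_abelianFourfold`,
file `WeilClassesFourfolds`), THEN every rational `(p,p)`-class on every complex abelian variety of
dimension `≤ 5` is algebraic (`Markman2025_hodgeClasses_algebraic_abelian_dim_le_five`, the sibling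
`dim ≤ 5` fact: the cycle part of the summit statement for `A.X`).
Faithfulness: every imaginary quadratic `k ⊂ End⁰(B)` is `ℚ(φ)` for such a `φ` (`k ∩ End(B)` is an
order `ℤ + f·𝒪_k`, containing `f√-δ₀` with `(f√-δ₀)² = -f²δ₀ ∈ -ℕ`), with the same eigenspaces
`V± ⊂ H¹(B, ℂ)`, hence the same plane `⋀⁴V₊ ⊕ ⋀⁴V₋ = W_k ⊗ ℂ`; `W_k` is spanned by rational classes
and, when it consists of Hodge classes, they are of type `(2,2)` — so the antecedent makes every
`W_k ⊂ B²` of every abelian fourfold algebraic, which is the input of Thms. 0.1–0.2; divisor classes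
are algebraic (Lefschetz `(1,1)`, Voisin I Thm. 11.30), cup products and pull-backs of algebraic
classes are algebraic, and Hodge classes / algebraicity are isogeny-invariant, so "generated by"
yields algebraicity of every rational `(p,p)`-class in every degree `2p`. Nothing stronger than the
summit statement is claimed (the conclusion is its cycle part on abelian varieties of dimension
`≤ 5`). [cite: MoonenZarhin1999LowDim, Thm. 0.1, Thm. 0.2 and (1.9)]
[cite: Markman2025SurveySecant, §1.1 (paragraph before Cor. 1.3), proof of Cor. 1.3 and Abstract]
[cite: MoonenZarhin1995Duke, main theorem (van Geemen 1994 Thm. 4.12)]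
[cite: vanGeemen1994HodgeAV, §2.4 and Thm. 4.6] [cite: RamonMari2008, Prop. 2.18]
[file AlgebraicGeometry/HodgeTheory/AbelianLowDimensionWeilReduction] -/
def MoonenZarhin1999_hodgeClasses_abelian_dim_le_five_of_weilClassesFourfolds : Prop :=
  Markman2025_weilClasses_algebraic_abelianFourfold →
    Markman2025_hodgeClasses_algebraic_abelian_dim_le_five

end Literature.AlgebraicGeometry.HodgeTheory
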